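import Summits.AtomisticToContinuum.HydrodynamicLimit.Theorems.SuperextensiveClosureCostTransferInequalityTools
import HarnessLib

/-!
# Extensive transfer along the flow (crux `LightConeInLaw`, stmt-AtomisticToContinuum-12500), tools:
# the static `L²` budget `LG(S)² ≤ e^{C(N+1)} · G_{θe}(S)` with a GUARD-UNIFORM constant

Support file (`--supports stmt-AtomisticToContinuum-12500`, route `RelayRaceLocality`, sub-problem
`HydrodynamicLimit`; lead c7, line `count-sufficiency-reduction`, tool L1 of the r2 crux card
`virgin-front-energy-budget` ≈ `clean-territory-island`, typed as `VirginFront.ExtensiveTransferAlongFlow` in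
`Cruxes/LightConeInLaw/IdeatorFourSketch.lean`).

The landed static `L²` transfer budget `TransferBudget.localGibbsMeasure_sq_le_exp_mul`
(`Theorems/SuperextensiveClosureCostTransferInequality.lean`, item `TransferInequality`) states
`localGibbsMeasure σ a₀ u₀ θ₀ N S ² ≤ e^{C(N+1)} · localGibbsMeasure σ 1 0 θe N S` with a constant `C`
chosen AFTER the profile `(a₀, u₀, θ₀)` and the reduced density `σ`. The typed statement
`ExtensiveTransferAlongFlow` quantifies `∃ h` BEFORE the guarded profiles and before `σ`, so this file
re-proves the budget with a constant depending only on the guard bounds: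

* `exists_sq_div_le_localMaxwellian_unif` — Gaussian domination `f²/g ≤ K · M_{1,u₀(x),θ'}` with
  `K, θ'` depending only on `(A, ϑ, Θ, U, θe)` (`0 ≤ a₀ ≤ A`, `ϑ ≤ θ₀ ≤ Θ < 2θe`, `‖u₀‖ ≤ U`), valid for
  EVERY profile obeying the bounds (verbatim the computation of
  `TransferBudget.exists_sq_div_le_localMaxwellian`, quantifiers reordered);
* `localGibbsMeasure_sq_le_exp_mul_unif` — the `L²` budget with `C = K / (a/3)²` for all profiles with
  `a ≤ a₀ ≤ A`, `ϑ ≤ θ₀ ≤ Θ`, `‖u₀‖ ≤ U` and ALL `0 < σ < 1/2` (the free-volume factor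
  `1 − 4πσ³/3 ≥ 1/3` is bounded below uniformly), verbatim the Cauchy–Schwarz argument of
  `TransferBudget.localGibbsMeasure_sq_le_exp_mul`.

References: C. Kipnis, C. Landim, *Scaling Limits of Interacting Particle Systems* (1999), App. 1 §8
(entropy and `L²` bounds between a local equilibrium and the invariant state); H. Spohn, *Large Scale
Dynamics of Interacting Particles* (1991), Part I §2.3; D. Ruelle, *Statistical Mechanics* (1969), §3.4.
-/

noncomputable section

open MeasureTheory Set Filter Topology
open scoped ENNReal

namespace Summit.AtomisticToContinuum.HydrodynamicLimit.Theorems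

namespace LightConeInLawTransfer

open Literature.Analysis.FluidPDE Literature.MathematicalPhysics.KineticTheory
open TransferBudget

/-! ### Gaussian domination of `f²/g`, uniformly over guarded profiles -/

/-- **Gaussian domination of `f²/g`, uniform in the profile.** For bounds `A`, `U`, `0 < ϑ`, `0 < Θ`,
`0 < θe` with `Θ < 2θe` there are `K ≥ 0` and `θ' > 0` such that for EVERY profile with
`0 ≤ a₀ ≤ A`, `ϑ ≤ θ₀ ≤ Θ`, `‖u₀‖ ≤ U` the square of the one-body local Gibbs profile
`f = a₀(x) M_{1,u₀(x),θ₀(x)}` divided by the homogeneous profile `g = M_{1,0,θe}` is dominated,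
uniformly in `x`, by `K · M_{1,u₀(x),θ'}(v)`, `θ' = 2θeΘ/(2θe − Θ)` (complete the square,
`TransferBudget.exponent_bound`). Same computation as `TransferBudget.exists_sq_div_le_localMaxwellian`,
with the constant chosen before the profile. [cite: KipnisLandim1999, App. 1 §8] -/
theorem exists_sq_div_le_localMaxwellian_unif {A Θ ϑ U θe : ℝ} (hϑ0 : 0 < ϑ) (hΘ0 : 0 < Θ)
    (hθe : 0 < θe) (hlt : Θ < 2 * θe) :
    ∃ K θ' : ℝ, 0 ≤ K ∧ 0 < θ' ∧ ∀ (a₀ θ₀ : T3 → ℝ) (u₀ : T3 → V3), (∀ x, 0 ≤ a₀ x) →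
      (∀ x, a₀ x ≤ A) → (∀ x, ϑ ≤ θ₀ x) → (∀ x, θ₀ x ≤ Θ) → (∀ x, ‖u₀ x‖ ≤ U) →
      ∀ (x : T3) (v : V3),
      localGibbsProfile a₀ u₀ θ₀ (x, v) ^ 2 /
          localGibbsProfile (fun _ => 1) (fun _ => (0 : V3)) (fun _ => θe) (x, v) ≤
        K * localMaxwellian 1 θ' (u₀ x) v := by
  set δ : ℝ := 2 * θe - Θ with hδ
  have hδ0 : 0 < δ := by rw [hδ]; linarith
  set θ' : ℝ := 2 * θe * Θ / δ with hθ'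
  have hθ'0 : 0 < θ' := by positivity
  set d : ℝ := (Module.finrank ℝ V3 : ℝ) with hd
  have hd0 : 0 ≤ d := by rw [hd]; exact_mod_cast Nat.zero_le _
  set c₁ : ℝ := (2 * Real.pi * ϑ) ^ (-d / 2) with hc₁
  set pe : ℝ := (2 * Real.pi * θe) ^ (-d / 2) with hpe
  set p' : ℝ := (2 * Real.pi * θ') ^ (-d / 2) with hp'
  have hc₁0 : 0 < c₁ := Real.rpow_pos_of_pos (by positivity) _
  have hpe0 : 0 < pe := Real.rpow_pos_of_pos (by positivity) _
  have hp'0 : 0 < p' := Real.rpow_pos_of_pos (by positivity) _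
  set C₀ : ℝ := (1 + 2 * Θ / δ) * U ^ 2 / (2 * θe) with hC₀
  refine ⟨A ^ 2 * c₁ ^ 2 * Real.exp C₀ / (pe * p'), θ', by positivity, hθ'0, ?_⟩
  intro a₀ θ₀ u₀ ha0 hA hϑ hΘ hU x v
  have hθx : 0 < θ₀ x := hϑ0.trans_le (hϑ x)
  set s : ℝ := ‖v - u₀ x‖ with hs
  set r : ℝ := ‖u₀ x‖ with hr
  have hs0 : 0 ≤ s := norm_nonneg _
  have hr0 : 0 ≤ r := norm_nonneg _
  -- the three profiles, unfolded
  set p₀ : ℝ := (2 * Real.pi * θ₀ x) ^ (-d / 2) with hp₀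
  have hp₀0 : 0 < p₀ := Real.rpow_pos_of_pos (by positivity) _
  set e₁ : ℝ := Real.exp (-s ^ 2 / (2 * θ₀ x)) with he₁
  set e₂ : ℝ := Real.exp (-‖v‖ ^ 2 / (2 * θe)) with he₂
  set e' : ℝ := Real.exp (-s ^ 2 / (2 * θ')) with he'
  have hf : localGibbsProfile a₀ u₀ θ₀ (x, v) = a₀ x * (p₀ * e₁) := by
    simp only [localGibbsProfile, localMaxwellian, one_mul, hp₀, he₁, hs]
    rfl
  have hg : localGibbsProfile (fun _ => 1) (fun _ => (0 : V3)) (fun _ => θe) (x, v) = pe * e₂ := by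
    simp only [localGibbsProfile, localMaxwellian, one_mul, hpe, he₂, sub_zero]
    rfl
  have hM : localMaxwellian 1 θ' (u₀ x) v = p' * e' := by
    simp only [localMaxwellian, one_mul, hp', he', hs]
    rfl
  have hgpos : 0 < pe * e₂ := mul_pos hpe0 (Real.exp_pos _)
  -- factor bounds
  have h1 : a₀ x ^ 2 ≤ A ^ 2 := pow_le_pow_left₀ (ha0 x) (hA x) 2
  have h2 : p₀ ^ 2 ≤ c₁ ^ 2 := by
    have hpre : p₀ ≤ c₁ :=
      Real.rpow_le_rpow_of_nonpos (by positivity) (by nlinarith [hϑ x, Real.pi_pos]) (by linarith)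
    exact pow_le_pow_left₀ hp₀0.le hpre 2
  have h3 : e₁ ^ 2 ≤ Real.exp C₀ * e' * e₂ := by
    have hquot : e₁ ^ 2 / e₂ = Real.exp (-s ^ 2 / θ₀ x + ‖v‖ ^ 2 / (2 * θe)) := by
      rw [he₁, he₂, sq, ← Real.exp_add, ← Real.exp_sub]
      congr 1
      field_simp
      ring
    have hexp : -s ^ 2 / θ₀ x + ‖v‖ ^ 2 / (2 * θe) ≤ C₀ + -s ^ 2 / (2 * θ') := by
      have hv : ‖v‖ ≤ s + r := by
        calc ‖v‖ = ‖(v - u₀ x) + u₀ x‖ := by rw [sub_add_cancel]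
          _ ≤ ‖v - u₀ x‖ + ‖u₀ x‖ := norm_add_le _ _
      have hv2 : ‖v‖ ^ 2 ≤ (s + r) ^ 2 := pow_le_pow_left₀ (norm_nonneg v) hv 2
      have ha : -s ^ 2 / θ₀ x ≤ -s ^ 2 / Θ := by
        rw [neg_div, neg_div, neg_le_neg_iff]
        exact div_le_div_of_nonneg_left (sq_nonneg _) hθx (hΘ x)
      have hb : ‖v‖ ^ 2 / (2 * θe) ≤ (s + r) ^ 2 / (2 * θe) :=
        div_le_div_of_nonneg_right hv2 (by positivity)
      have hc := exponent_bound (s := s) (r := r) hΘ0 hθe hlt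
      have hr2 : r ^ 2 ≤ U ^ 2 := pow_le_pow_left₀ hr0 (hU x) 2
      have hdd : (1 + 2 * Θ / (2 * θe - Θ)) * r ^ 2 / (2 * θe) ≤ C₀ := by
        rw [hC₀]
        refine div_le_div_of_nonneg_right ?_ (by positivity)
        exact mul_le_mul_of_nonneg_left hr2 (by positivity)
      have hee : -((2 * θe - Θ) / (4 * θe * Θ) * s ^ 2) = -s ^ 2 / (2 * θ') := by
        rw [hθ']
        field_simp
        ring
      linarith
    rw [← div_le_iff₀ (Real.exp_pos _), hquot, he', ← Real.exp_add]
    exact Real.exp_le_exp.2 hexp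
  -- assembly
  rw [hf, hg, hM, div_le_iff₀ hgpos]
  calc (a₀ x * (p₀ * e₁)) ^ 2 = a₀ x ^ 2 * p₀ ^ 2 * e₁ ^ 2 := by ring
    _ ≤ A ^ 2 * c₁ ^ 2 * (Real.exp C₀ * e' * e₂) := by gcongr
    _ = A ^ 2 * c₁ ^ 2 * Real.exp C₀ / (pe * p') * (p' * e') * (pe * e₂) := by
        field_simp

/-! ### The `L²` budget with a guard-uniform constant -/

/-- For `0 < σ < 1/2` the free-volume factor is at least `1/3`: `1/3 ≤ 1 − 4πσ³/3`
(`σ³ < 1/8`, `π ≤ 4`). [folklore] -/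
theorem third_le_freeVolumeFactor {σ : ℝ} (hσ0 : 0 < σ) (hσ : σ < 1 / 2) :
    1 / 3 ≤ 1 - 4 * Real.pi / 3 * σ ^ 3 := by
  have hσ3 : σ ^ 3 < 1 / 8 := by
    have := pow_lt_pow_left₀ hσ hσ0.le (three_ne_zero)
    norm_num at this
    exact this
  nlinarith [Real.pi_le_four, Real.pi_pos, pow_pos hσ0 3]

/-- **The static `L²` budget with a guard-uniform constant.** For bounds `0 < a`, `A`, `U`, `0 < ϑ`,
`0 < Θ`, `0 < θe` with `Θ < 2θe` there is `C ≥ 0` such that for EVERY continuous profile with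
`a ≤ a₀ ≤ A`, `ϑ ≤ θ₀ ≤ Θ`, `‖u₀‖ ≤ U`, EVERY reduced density `0 < σ < 1/2`, every particle number and
every set `S` of phase space,
`localGibbsMeasure σ a₀ u₀ θ₀ N S ² ≤ e^{C(N+1)} · localGibbsMeasure σ 1 0 θe N S`.
Proof: verbatim the Cauchy–Schwarz argument of `TransferBudget.localGibbsMeasure_sq_le_exp_mul`
(outer regularity; factorisation `ρ_LG = Z_LG⁻¹ Z_G (∏ᵢ f/g) ρ_G`; `∫∫ f²/g ≤ K` from
`exists_sq_div_le_localMaxwellian_unif`; `Z_G ≤ 1`; `Z_LG ≥ (a(1 − 4πσ³/3))^{N+1} ≥ (a/3)^{N+1}`),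
with `C = K/(a/3)²`. [cite: KipnisLandim1999, App. 1 §8] -/
theorem localGibbsMeasure_sq_le_exp_mul_unif {A a Θ ϑ U θe : ℝ} (ha_pos : 0 < a) (hϑ0 : 0 < ϑ)
    (hΘ0 : 0 < Θ) (hθe : 0 < θe) (hlt : Θ < 2 * θe) :
    ∃ C : ℝ, 0 ≤ C ∧ ∀ (a₀ θ₀ : T3 → ℝ) (u₀ : T3 → V3), Continuous a₀ → Continuous θ₀ →
      Continuous u₀ → (∀ x, a ≤ a₀ x) → (∀ x, a₀ x ≤ A) → (∀ x, ϑ ≤ θ₀ x) → (∀ x, θ₀ x ≤ Θ) →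
      (∀ x, ‖u₀ x‖ ≤ U) → ∀ {σ : ℝ}, 0 < σ → σ < 1 / 2 →
      ∀ (N : ℕ) (S : Set (Config (N + 1) (Fin 3) T3)),
      localGibbsMeasure σ a₀ u₀ θ₀ N S ^ 2 ≤
        ENNReal.ofReal (Real.exp (C * (N + 1))) *
          localGibbsMeasure σ (fun _ => 1) (fun _ => (0 : V3)) (fun _ => θe) N S := by
  obtain ⟨K, θ', hK, hθ', hdomU⟩ :=
    exists_sq_div_le_localMaxwellian_unif (A := A) (U := U) hϑ0 hΘ0 hθe hlt
  set L : ℝ := K / (a / 3) ^ 2 with hL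
  have hL0 : 0 ≤ L := by positivity
  refine ⟨L, hL0, ?_⟩
  intro a₀ θ₀ u₀ ha hθ hu haa hA hϑ hΘ hU σ hσ0 hσ N S
  have ha0 : ∀ x, 0 < a₀ x := fun x => ha_pos.trans_le (haa x)
  have ha0' : ∀ x, 0 ≤ a₀ x := fun x => (ha0 x).le
  have hθ0 : ∀ x, 0 < θ₀ x := fun x => hϑ0.trans_le (hϑ x)
  have hdom := hdomU a₀ θ₀ u₀ ha0' hA hϑ hΘ hU
  have hI := lintegral_sq_div_le (a₀ := a₀) (θ₀ := θ₀) hu hK hθ' hdom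
  -- the free-volume factor
  set q : ℝ := 1 - 4 * Real.pi / 3 * σ ^ 3 with hq
  have hq3 : 1 / 3 ≤ q := third_le_freeVolumeFactor hσ0 hσ
  have hq0 : 0 < q := lt_of_lt_of_le (by norm_num) hq3
  -- notation
  set ε := hsDiameter σ N with hε
  set f : T3 × V3 → ℝ := localGibbsProfile a₀ u₀ θ₀ with hf
  set g : T3 × V3 → ℝ := localGibbsProfile (fun _ => 1) (fun _ => (0 : V3)) (fun _ => θe) with hg
  set D : Set (Config (N + 1) (Fin 3) T3) := hardSphereDomain (Torus.geometry (Fin 3)) (N + 1) ε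
    with hD
  set Zf : ℝ := posPartition a₀ ε (N + 1) with hZf
  set Zg : ℝ := posPartition (fun _ => (1 : ℝ)) ε (N + 1) with hZg
  have hf0 : ∀ y, 0 ≤ f y := fun y => localGibbsProfile_nonneg ha0' (fun x => (hθ0 x).le) y
  have hgpos : ∀ y, 0 < g y := fun y =>
    mul_pos one_pos (localMaxwellian_pos one_pos hθe _ _)
  have hfm : Measurable f := measurable_localGibbsProfile ha hθ hu
  have hgm : Measurable g := measurable_localGibbsProfile continuous_const continuous_const
    continuous_const
  have hZf_eq : canonicalPartition (Torus.geometry (Fin 3)) ε (N + 1) f = Zf :=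
    canonicalPartition_eq_posPartition ha hθ hu ha0' hθ0 _ _
  have hZg_eq : canonicalPartition (Torus.geometry (Fin 3)) ε (N + 1) g = Zg :=
    canonicalPartition_eq_posPartition continuous_const continuous_const continuous_const
      (fun _ => zero_le_one) (fun _ => hθe) _ _
  have hZg_pos : 0 < Zg := posPartition_pos continuous_const (fun _ => one_pos) hσ.le N
  have hZg_le : Zg ≤ 1 := posPartition_one_le_one ε (N + 1)
  have hZf_ge' : (a * q) ^ (N + 1) ≤ Zf := pow_le_posPartition ha ha_pos.le haa hσ0 hσ N
  have haq3 : a / 3 ≤ a * q := by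
    have : a * (1 / 3) ≤ a * q := mul_le_mul_of_nonneg_left hq3 ha_pos.le
    linarith
  have ha3 : 0 < a / 3 := by positivity
  have hZf_ge : (a / 3) ^ (N + 1) ≤ Zf :=
    (pow_le_pow_left₀ ha3.le haq3 (N + 1)).trans hZf_ge'
  have hZf_pos : 0 < Zf := (pow_pos ha3 _).trans_le hZf_ge
  -- densities
  set ρf : Config (N + 1) (Fin 3) T3 → ℝ :=
    canonicalDensity (Torus.geometry (Fin 3)) ε (N + 1) f with hρf
  set ρg : Config (N + 1) (Fin 3) T3 → ℝ :=
    canonicalDensity (Torus.geometry (Fin 3)) ε (N + 1) g with hρg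
  have hLG : localGibbsMeasure σ a₀ u₀ θ₀ N =
      volume.withDensity fun z => ENNReal.ofReal (ρf z) := rfl
  have hG : localGibbsMeasure σ (fun _ => 1) (fun _ => (0 : V3)) (fun _ => θe) N =
      volume.withDensity fun z => ENNReal.ofReal (ρg z) := rfl
  have hρgm : Measurable fun z => ENNReal.ofReal (ρg z) :=
    (measurable_canonicalDensity ε (N + 1) hgm).ennreal_ofReal
  set w : Config (N + 1) (Fin 3) T3 → ℝ≥0∞ := fun z => ENNReal.ofReal (∏ i, f (z i) / g (z i))
    with hw
  have hwm : Measurable w :=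
    (Finset.measurable_prod _ fun i _ =>
      (hfm.comp (measurable_pi_apply i)).div (hgm.comp (measurable_pi_apply i))).ennreal_ofReal
  set φ : T3 × V3 → ℝ := fun y => f y ^ 2 / g y with hφ
  have hφ0 : ∀ y, 0 ≤ φ y := fun y => div_nonneg (sq_nonneg _) (hgpos y).le
  have hφm : Measurable fun y => ENNReal.ofReal (φ y) := ((hfm.pow_const 2).div hgm).ennreal_ofReal
  set c : ℝ≥0∞ := ENNReal.ofReal (Zf⁻¹ * Zg) with hc
  -- (P1) factorisation of the local Gibbs density through the homogeneous one
  have P1 : ∀ z, ENNReal.ofReal (ρf z) = c * w z * ENNReal.ofReal (ρg z) := by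
    intro z
    simp only [hρf, hρg, canonicalDensity, hZf_eq, hZg_eq, hc, hw]
    by_cases hz : z ∈ D
    · rw [indicator_of_mem hz, indicator_of_mem hz, tensorPow, tensorPow,
        ← ENNReal.ofReal_mul (mul_nonneg (inv_nonneg.2 hZf_pos.le) hZg_pos.le),
        ← ENNReal.ofReal_mul (mul_nonneg (mul_nonneg (inv_nonneg.2 hZf_pos.le) hZg_pos.le)
          (Finset.prod_nonneg fun i _ => div_nonneg (hf0 _) (hgpos _).le))]
      congr 1
      have hprod : (∏ i, g (z i)) ≠ 0 := (Finset.prod_pos fun i _ => hgpos (z i)).ne'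
      rw [Finset.prod_div_distrib]
      field_simp
    · rw [indicator_of_notMem hz, indicator_of_notMem hz, mul_zero, mul_zero, ENNReal.ofReal_zero,
        mul_zero]
  -- (P2) the square of the ratio against the homogeneous density, dropping the hard core
  have P2 : ∀ z, w z ^ 2 * ENNReal.ofReal (ρg z) ≤
      ENNReal.ofReal Zg⁻¹ * ∏ i, ENNReal.ofReal (φ (z i)) := by
    intro z
    simp only [hρg, canonicalDensity, hZg_eq, hw, hφ]
    by_cases hz : z ∈ D
    · rw [indicator_of_mem hz, tensorPow,
        ← ENNReal.ofReal_pow (Finset.prod_nonneg fun i _ => div_nonneg (hf0 _) (hgpos _).le),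
        ← ENNReal.ofReal_mul (pow_nonneg
          (Finset.prod_nonneg fun i _ => div_nonneg (hf0 _) (hgpos _).le) _),
        ← ENNReal.ofReal_prod_of_nonneg fun i _ => hφ0 (z i),
        ← ENNReal.ofReal_mul (inv_nonneg.2 hZg_pos.le)]
      refine le_of_eq ?_
      congr 1
      have hprod : (∏ i, g (z i)) ≠ 0 := (Finset.prod_pos fun i _ => hgpos (z i)).ne'
      simp only [hφ]
      rw [Finset.prod_div_distrib, Finset.prod_div_distrib, Finset.prod_pow]
      field_simp
    · rw [indicator_of_notMem hz, mul_zero, ENNReal.ofReal_zero, mul_zero]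
      exact bot_le
  -- reduction to a measurable set
  set T := toMeasurable (localGibbsMeasure σ (fun _ => 1) (fun _ => (0 : V3)) (fun _ => θe) N) S
    with hT
  have hTm : MeasurableSet T := measurableSet_toMeasurable _ _
  have hST : S ⊆ T := subset_toMeasurable _ _
  have hGT : localGibbsMeasure σ (fun _ => 1) (fun _ => (0 : V3)) (fun _ => θe) N T =
      localGibbsMeasure σ (fun _ => 1) (fun _ => (0 : V3)) (fun _ => θe) N S := measure_toMeasurable S
  suffices hmain : localGibbsMeasure σ a₀ u₀ θ₀ N T ^ 2 ≤
      ENNReal.ofReal (Real.exp (L * (N + 1))) *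
        localGibbsMeasure σ (fun _ => 1) (fun _ => (0 : V3)) (fun _ => θe) N T by
    calc localGibbsMeasure σ a₀ u₀ θ₀ N S ^ 2 ≤ localGibbsMeasure σ a₀ u₀ θ₀ N T ^ 2 := by
          gcongr
      _ ≤ _ := hmain
      _ = _ := by rw [hGT]
  -- the local Gibbs mass of `T` as an integral against the homogeneous law
  have hLGT : localGibbsMeasure σ a₀ u₀ θ₀ N T =
      c * ∫⁻ z in T, w z ∂localGibbsMeasure σ (fun _ => 1) (fun _ => (0 : V3)) (fun _ => θe) N := by
    rw [hLG, withDensity_apply _ hTm]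
    simp_rw [P1, mul_assoc]
    rw [lintegral_const_mul' _ _ ENNReal.ofReal_ne_top, hG,
      setLIntegral_withDensity_eq_setLIntegral_mul _ hρgm hwm hTm]
    congr 1
    refine lintegral_congr fun z => ?_
    rw [Pi.mul_apply, mul_comm]
  -- Cauchy–Schwarz in `L²(G|_T)`
  have hCS := lintegral_sq_le_lintegral_sq_mul_measure_univ
    ((localGibbsMeasure σ (fun _ => 1) (fun _ => (0 : V3)) (fun _ => θe) N).restrict T)
    hwm.aemeasurable
  rw [Measure.restrict_apply_univ] at hCS
  -- the `L²` norm of the ratio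
  have hW2 : ∫⁻ z in T, w z ^ 2 ∂localGibbsMeasure σ (fun _ => 1) (fun _ => (0 : V3)) (fun _ => θe) N ≤
      ENNReal.ofReal Zg⁻¹ * ENNReal.ofReal K ^ (N + 1) := by
    calc ∫⁻ z in T, w z ^ 2 ∂localGibbsMeasure σ (fun _ => 1) (fun _ => (0 : V3)) (fun _ => θe) N
        ≤ ∫⁻ z, w z ^ 2 ∂localGibbsMeasure σ (fun _ => 1) (fun _ => (0 : V3)) (fun _ => θe) N :=
          setLIntegral_le_lintegral T _
      _ = ∫⁻ z, ENNReal.ofReal (ρg z) * w z ^ 2 := by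
          rw [hG, lintegral_withDensity_eq_lintegral_mul _ hρgm (hwm.pow_const 2)]
          rfl
      _ ≤ ∫⁻ z, ENNReal.ofReal Zg⁻¹ * ∏ i, ENNReal.ofReal (φ (z i)) :=
          lintegral_mono fun z => by rw [mul_comm]; exact P2 z
      _ = ENNReal.ofReal Zg⁻¹ * ∏ _i : Fin (N + 1), ∫⁻ y, ENNReal.ofReal (φ y) := by
          rw [lintegral_const_mul' _ _ ENNReal.ofReal_ne_top, volume_pi,
            @lintegral_fintype_prod_eq_prod' (Fin (N + 1)) _ (fun _ => T3 × V3) _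
              (fun _ => volume) (fun _ => inferInstance) (fun _ y => ENNReal.ofReal (φ y))
              (fun _ => hφm)]
      _ ≤ ENNReal.ofReal Zg⁻¹ * ENNReal.ofReal K ^ (N + 1) := by
          rw [Finset.prod_const, Finset.card_univ, Fintype.card_fin]
          gcongr
  -- the real-number budget
  have hreal : (Zf⁻¹ * Zg) ^ 2 * (Zg⁻¹ * K ^ (N + 1)) ≤ Real.exp (L * (N + 1)) := by
    have h1 : Zf⁻¹ ≤ ((a / 3) ^ (N + 1))⁻¹ := inv_anti₀ (pow_pos ha3 _) hZf_ge
    calc (Zf⁻¹ * Zg) ^ 2 * (Zg⁻¹ * K ^ (N + 1)) = Zf⁻¹ ^ 2 * Zg * K ^ (N + 1) := by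
          field_simp
      _ ≤ ((a / 3) ^ (N + 1))⁻¹ ^ 2 * 1 * K ^ (N + 1) := by gcongr
      _ = L ^ (N + 1) := by
          rw [hL, div_pow K ((a / 3) ^ 2) (N + 1), ← pow_mul, mul_comm 2 (N + 1), pow_mul, mul_one,
            inv_pow]
          exact (div_eq_inv_mul _ _).symm
      _ ≤ Real.exp (L * (N + 1)) := by
          have := pow_le_exp_mul hL0 (N + 1)
          push_cast at this
          exact this
  -- assembly
  calc localGibbsMeasure σ a₀ u₀ θ₀ N T ^ 2
      = c ^ 2 * (∫⁻ z in T, w z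
          ∂localGibbsMeasure σ (fun _ => 1) (fun _ => (0 : V3)) (fun _ => θe) N) ^ 2 := by
        rw [hLGT, mul_pow]
    _ ≤ c ^ 2 * ((∫⁻ z in T, w z ^ 2
          ∂localGibbsMeasure σ (fun _ => 1) (fun _ => (0 : V3)) (fun _ => θe) N) *
          localGibbsMeasure σ (fun _ => 1) (fun _ => (0 : V3)) (fun _ => θe) N T) := by
        gcongr
    _ ≤ c ^ 2 * ((ENNReal.ofReal Zg⁻¹ * ENNReal.ofReal K ^ (N + 1)) *
          localGibbsMeasure σ (fun _ => 1) (fun _ => (0 : V3)) (fun _ => θe) N T) := by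
        gcongr
    _ = ENNReal.ofReal ((Zf⁻¹ * Zg) ^ 2 * (Zg⁻¹ * K ^ (N + 1))) *
          localGibbsMeasure σ (fun _ => 1) (fun _ => (0 : V3)) (fun _ => θe) N T := by
        rw [hc, ← mul_assoc, ← ENNReal.ofReal_pow (mul_nonneg (inv_nonneg.2 hZf_pos.le) hZg_pos.le),
          ← ENNReal.ofReal_pow hK, ← ENNReal.ofReal_mul (inv_nonneg.2 hZg_pos.le),
          ← ENNReal.ofReal_mul (pow_nonneg (mul_nonneg (inv_nonneg.2 hZf_pos.le) hZg_pos.le) _)]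
    _ ≤ ENNReal.ofReal (Real.exp (L * (N + 1))) *
          localGibbsMeasure σ (fun _ => 1) (fun _ => (0 : V3)) (fun _ => θe) N T := by
        gcongr

/-- **Registered sub-goal `guardUniformTransferBudget`** (crux stmt-AtomisticToContinuum-12500, lead c7):
the static `L²` budget with a constant depending only on the guard bounds — for `0 < a`, `0 < ϑ`,
`0 < Θ`, `0 < θe`, `Θ < 2θe` there is `C ≥ 0` with
`localGibbsMeasure σ a₀ u₀ θ₀ N S ² ≤ e^{C(N+1)} · localGibbsMeasure σ 1 0 θe N S` for every continuous
profile with `a ≤ a₀ ≤ A`, `ϑ ≤ θ₀ ≤ Θ`, `‖u₀‖ ≤ U`, every `0 < σ < 1/2`, every `N` and every set `S`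
(`localGibbsMeasure_sq_le_exp_mul_unif`, quantifiers in prenex form). [cite: KipnisLandim1999, App. 1 §8] -/
theorem guardUniformTransferBudget :
    ∀ (A a Θ ϑ U θe : ℝ), 0 < a → 0 < ϑ → 0 < Θ → 0 < θe → Θ < 2 * θe →
    ∃ C : ℝ, 0 ≤ C ∧ ∀ (a₀ θ₀ : T3 → ℝ) (u₀ : T3 → V3), Continuous a₀ → Continuous θ₀ →
      Continuous u₀ → (∀ x, a ≤ a₀ x) → (∀ x, a₀ x ≤ A) → (∀ x, ϑ ≤ θ₀ x) → (∀ x, θ₀ x ≤ Θ) →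
      (∀ x, ‖u₀ x‖ ≤ U) → ∀ σ : ℝ, 0 < σ → σ < 1 / 2 →
      ∀ (N : ℕ) (S : Set (Config (N + 1) (Fin 3) T3)),
      localGibbsMeasure σ a₀ u₀ θ₀ N S ^ 2 ≤
        ENNReal.ofReal (Real.exp (C * (N + 1))) *
          localGibbsMeasure σ (fun _ => 1) (fun _ => (0 : V3)) (fun _ => θe) N S := by
  intro A a Θ ϑ U θe ha hϑ hΘ hθe hlt
  obtain ⟨C, hC0, hC⟩ := localGibbsMeasure_sq_le_exp_mul_unif (A := A) (U := U) ha hϑ hΘ hθe hlt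
  exact ⟨C, hC0, fun a₀ θ₀ u₀ h1 h2 h3 h4 h5 h6 h7 h8 σ hσ0 hσ N S =>
    hC a₀ θ₀ u₀ h1 h2 h3 h4 h5 h6 h7 h8 hσ0 hσ N S⟩

end LightConeInLawTransfer

end Summit.AtomisticToContinuum.HydrodynamicLimit.Theorems

end
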